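import Summits.KontsevichZagierPeriods.KontsevichZagierPeriods.Theses.HermiteRigidity
import Summits.KontsevichZagierPeriods.KontsevichZagierPeriods.Theses.SymplecticScissors
import Summits.KontsevichZagierPeriods.KontsevichZagierPeriods.Theorems.HermiteRigidityAssembly
import Summits.KontsevichZagierPeriods.KontsevichZagierPeriods.Theorems.HermiteRigidityReductionRigidityOfKernelForm
import Summits.KontsevichZagierPeriods.KontsevichZagierPeriods.Theorems.PlanarAreas.Negative.Core
import Literature.NumberTheory.Transcendental.KZKernelConjectureForms
import Literature.NumberTheory.Transcendental.KZVolumeConjectureProofs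

/-!
# KontsevichZagierPeriods / HermiteRigidity — the crux `ReductionRigidity` (stmt-KontsevichZagierPeriods-3407) is the summit, and is the volume frame `VolumeForm` (stmt-KontsevichZagierPeriods-3814)

Route `KontsevichZagierPeriods/HermiteRigidity`, rank-0 crux stmt-KontsevichZagierPeriods-3407
(`ReductionRigidity`, REDUCTION + RIGIDITY: a family `B` of integral representations whose values
are linearly independent over the real algebraic numbers, into whose rescaling subgroup `N(B)` every
rational-shape representation reduces modulo `KZ.relations`).

This file records, as tree theorems attached to the crux (`--supports`), the exact position of the
crux in the obligation graph — the composition behind the line `compact-volume-basis`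
(crux workfile `Cruxes/ReductionRigidity/SketchIdeator2.lean`) and behind the standing disprover's
§1 (`Cruxes/ReductionRigidity/Disproof.lean`), both of which live outside `Theorems/`:

* `reductionRigidity_iff_kontsevichZagierPeriods` — the crux is LITERALLY EQUIVALENT to the summit:
  `→` is the landed assembly `Assembly.assembly_proof` (the route's deciding theorem `closes` fed
  with the landed support `RigidKernel`); `←` is summit ⇒ kernel form
  (`kzPeriodConjecture'_iff_isRational`, `KZKernelConjecture.of_kzPeriodConjecture'`) followed by
  the landed glue `ReductionRigidityOfKernelForm.reductionRigidityOfKernelForm_proof`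
  (kernel form ⇒ crux, a Hamel-type choice over the real algebraic numbers).
* `volumeForm_iff_kontsevichZagierPeriods`, `reductionRigidity_iff_volumeForm`,
  `reductionRigidity_of_volumeForm` — the crux is equivalent to the shared frame item `VolumeForm`
  (stmt-KontsevichZagierPeriods-3814; two integrand-`1` representations of one dimension with equal
  volume are KZ-equivalent): `VolumeForm` gives the compact volume form of Conjecture 1, which gives
  Conjecture 1 by Viu-Sos' semi-canonical reduction inside the rules (tree theorems
  `KZ.semiCanonicalReduction_holds`, `KZ.kzPeriodConjecture'_of_volumeConjectureCompact`);
  conversely the summit gives `VolumeForm` (`PlanarAreas.Negative.volumeForm_of_summit`, integrand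
  `1` is KZ-literal data).

Consequently the single open input ("stub") of every line for this crux is summit-strength; the
line lead's registered skeleton is `stub_volumeForm (= stmt-3814) ↦ ReductionRigidity`, i.e.
`reductionRigidity_of_volumeForm` below with the stub as argument.

References: M. Kontsevich, D. Zagier, *Periods* (2001), §1.2 (Conjecture 1); J. Viu-Sos,
*A semi-canonical reduction for periods of Kontsevich–Zagier*, IJNT 17 (2021), Thm. 1.1;
J. Cresson, J. Viu-Sos, JTNB 34 (2022), §1 (volume form); A. Huber, S. Müller-Stach,
*Periods and Nori Motives* (2017), §13.1.
-/

noncomputable section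

namespace Summit.KontsevichZagierPeriods.HermiteRigidity.ReductionRigidity

open Literature.NumberTheory.Transcendental
open Summit.KontsevichZagierPeriods.KontsevichZagierPeriods.Theses.HermiteRigidity (ReductionRigidity)
open Summit.KontsevichZagierPeriods.KontsevichZagierPeriods.Theses.SymplecticScissors (VolumeForm)

/-- **Crux ⇒ summit**: `ReductionRigidity → KontsevichZagierPeriods` is the route's assembly
(stmt-3417), landed as `Assembly.assembly_proof` (deciding theorem `closes` + `RigidKernel`).
[Kontsevich–Zagier 2001, §1.2] [folklore] -/
theorem kontsevichZagierPeriods_of_reductionRigidity (h : ReductionRigidity) :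
    _root_.KontsevichZagierPeriods :=
  (id Summit.KontsevichZagierPeriods.HermiteRigidity.Assembly.assembly_proof :
    ReductionRigidity → _root_.KontsevichZagierPeriods) h

/-- **Summit ⇒ crux**: Conjecture 1 in its printed two-representation shape gives the kernel form
`ker eval = relations` (`kzPeriodConjecture'_iff_isRational`, `KZKernelConjecture.of_kzPeriodConjecture'`:
every formal combination is `≡ [r] − [r']` modulo moves), and the kernel form gives the crux by the
landed glue `ReductionRigidityOfKernelForm` (stmt-14406: `B` = a section of `value` over a maximal
real-algebraically independent subfamily of all values).
[Kontsevich–Zagier 2001, §1.2; Huber–Müller-Stach 2017, §13.1] [folklore] -/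
theorem reductionRigidity_of_kontsevichZagierPeriods (h : _root_.KontsevichZagierPeriods) :
    ReductionRigidity :=
  have hker : ∀ c : KZ.FormalRep, KZ.eval c = 0 → c ∈ KZ.relations := fun c hc =>
    KZKernelConjecture.of_kzPeriodConjecture' (kzPeriodConjecture'_iff_isRational.mpr h) c hc
  (id Summit.KontsevichZagierPeriods.HermiteRigidity.ReductionRigidityOfKernelForm.reductionRigidityOfKernelForm_proof :
    (∀ c : KZ.FormalRep, KZ.eval c = 0 → c ∈ KZ.relations) → ReductionRigidity) hker

/-- **The crux `ReductionRigidity` (stmt-3407) is equivalent to the summit `KontsevichZagierPeriods`**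
(REDUCTION + RIGIDITY is Conjecture 1 modulo a Hamel-basis choice over the real algebraic numbers).
[Kontsevich–Zagier 2001, §1.2; Huber–Müller-Stach 2017, §13.1] [folklore] -/
theorem reductionRigidity_iff_kontsevichZagierPeriods :
    ReductionRigidity ↔ _root_.KontsevichZagierPeriods :=
  ⟨kontsevichZagierPeriods_of_reductionRigidity, reductionRigidity_of_kontsevichZagierPeriods⟩

/-- **Frame ⇒ summit**: the volume frame `VolumeForm` (stmt-3814: integrand-`1` representations of
one dimension with equal volume are KZ-equivalent) implies Conjecture 1 — it contains the compact
volume form of Cresson–Viu-Sos, which implies the two-representation form by Viu-Sos'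
semi-canonical reduction inside the rules (`KZ.semiCanonicalReduction_holds`,
`KZ.kzPeriodConjecture'_of_volumeConjectureCompact`), and that is the summit by
`kzPeriodConjecture'_iff_isRational`. [Viu-Sos 2021, Thm. 1.1; Cresson–Viu-Sos 2022, §1] [folklore] -/
theorem kontsevichZagierPeriods_of_volumeForm (h : VolumeForm) : _root_.KontsevichZagierPeriods :=
  fun _ _ r r' hr hr' hv =>
    kzPeriodConjecture'_iff_isRational.mp
      (KZ.kzPeriodConjecture'_of_volumeConjectureCompact KZ.semiCanonicalReduction_holds
        fun _ s s' _ _ _ _ hs hs' hsv => h s s' hs hs' hsv)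
      r r' hr hr' hv

/-- The frame is equivalent to the summit (`←` is the landed
`PlanarAreas.Negative.volumeForm_of_summit`: integrand `1` is KZ-literal data).
[Viu-Sos 2021, Thm. 1.1; Cresson–Viu-Sos 2022, §1] [folklore] -/
theorem volumeForm_iff_kontsevichZagierPeriods : VolumeForm ↔ _root_.KontsevichZagierPeriods :=
  ⟨kontsevichZagierPeriods_of_volumeForm,
    Summit.KontsevichZagierPeriods.PlanarAreas.Negative.volumeForm_of_summit⟩

/-- **The crux `ReductionRigidity` (stmt-3407) is equivalent to the shared frame `VolumeForm`
(stmt-3814)**, both being the summit. [Viu-Sos 2021, Thm. 1.1; Cresson–Viu-Sos 2022, §1;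
Kontsevich–Zagier 2001, §1.2] [folklore] -/
theorem reductionRigidity_iff_volumeForm : ReductionRigidity ↔ VolumeForm :=
  reductionRigidity_iff_kontsevichZagierPeriods.trans volumeForm_iff_kontsevichZagierPeriods.symm

/-- **The line's composition** (`compact-volume-basis`; the lead's registered skeleton has the single
stub `VolumeForm` = stmt-3814): `VolumeForm → ReductionRigidity`. When item 3814 closes, the crux
closes by this theorem applied to `VolumeForm_holds`.
[Viu-Sos 2021, Thm. 1.1; Cresson–Viu-Sos 2022, §1; Kontsevich–Zagier 2001, §1.2] [folklore] -/
theorem reductionRigidity_of_volumeForm : Summit.KontsevichZagierPeriods.KontsevichZagierPeriods.Theses.SymplecticScissors.VolumeForm → Summit.KontsevichZagierPeriods.KontsevichZagierPeriods.Theses.HermiteRigidity.ReductionRigidity :=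
  reductionRigidity_iff_volumeForm.mpr

/-- Conversely the crux gives the frame. [folklore] -/
theorem volumeForm_of_reductionRigidity (h : ReductionRigidity) : VolumeForm :=
  reductionRigidity_iff_volumeForm.mp h

end Summit.KontsevichZagierPeriods.HermiteRigidity.ReductionRigidity

end
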